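import Summits.BirchSwinnertonDyer.BirchSwinnertonDyer.Theorems.ResidualThetaTransportAtTwoSignedMuSeedAtTwoPlusPrimLayerZero
import Summits.BirchSwinnertonDyer.Rank1Residual.Iwasawa.InertiaCohomologyPTorsionFinite
import Literature.NumberTheory.GaloisRepresentations.TateH2VanishingArchimedean
import HarnessLib

/-!
# Line `norm-one-torus` of the crux `SignedMuSeedAtTwoPlus` (stmt-BirchSwinnertonDyer-21438; = `stub_residualSeedAtTwo` of Kμ⁺
# stmt-BirchSwinnertonDyer-20689 BY NAME): the layer-`0` reading of the `q = 1` certificate with the conditions AWAY FROM `2`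
# moved down to `ℚ_0` — unramified-at-odd-places and archimedean conditions of a restricted class are conditions on the class itself
# (width seat bsd-wall-rtt-p4-w3 g6; `--supports stmt-BirchSwinnertonDyer-21438`; closes nothing)

HONEST FRAMING. THEOREMS ONLY (no `def`, no named fact, no `sorry`); nothing about any particular curve is asserted; BSD is not
proved by any of this. Continuation of `…PrimLayerZero` (p609373: `PrimCertificate W κ γ 1 ⟺ R₀ = 0` with the three local
conditions of `R₀` still read on the restriction to `ℚ_∞`). Here the two conditions AWAY from `2` are brought down to `ℚ_0`:

* `§1` (any topological group) `resOfLe_bijective_of_eq` — restriction along an EQUALITY of subgroups is a bijection.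
* `§2` (any number field `K`, any `ℤ_p`-extension `κ`) `decompInf_le_kerSubgroup` — every archimedean decomposition group lies in
  `ker κ` (it has order `≤ 2` and `ℤ_p` is torsion-free); with the tree's `inertia_le_kerSubgroup'` (`I_v ≤ ker κ` for `v ∤ p`).
* `§3` (subgroups `H' ≤ H` of `Γ_K`) `resOfLe_mem_unramifiedKer_iff` — if `I_v ≤ H'` then `res c ∈ unramifiedKer H' v ↔ c ∈ unramifiedKer H v`
  (both are «`c|_{I_v} = 0`»: functoriality `resH1Hom_comp` + §1 on `H' ⊓ I_v = H ⊓ I_v`); `resOfLe_mem_infKer_iff` — the same at an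
  infinite place `w` with `D_w ≤ H'`.
* `§4` `primCertificate_one_iff_layerZero_local` — for `W/ℚ` globally minimal good supersingular at `2`, `κ` with topological
  generator `γ`: `PrimCertificate W κ γ 1` (unfolded) **iff** every `c₀ ∈ H¹(ℚ_0, W[2^∞][2])` that is (a₀) unramified at every odd
  place OVER `ℚ_0` (`unramifiedOutside (κ.layerSubgroup 0) _ 2 ∅`), (b₀) locally trivial at `∞` OVER `ℚ_0` (`infKer (κ.layerSubgroup 0)`),
  and (c) whose restriction to `ℚ_∞` is signed-plus at `2`, vanishes. Only (c) is still read over `ℚ_∞` (its descent to `ℚ_0` is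
  the signed comparison INJ⁺@2 for the residual module — not done here).

References: [GreenbergLNM1716] §3 Lemmas 3.1–3.2; [Washington1997] Prop. 13.2 (`ℤ_p`-extensions are unramified outside `p`);
[SerreGaloisCohomology1997] I §2.4; [Greenberg1989] §1 p. 98 (3); [GreenbergVatsal2000] §2 p. 17.
-/

set_option autoImplicit false
-- D-0017: single-problem summit, so `Summit.BirchSwinnertonDyer.BirchSwinnertonDyer.…` repeats a namespace BY DESIGN.
set_option linter.dupNamespace false

noncomputable section

open scoped Classical AddSubgroup

open WeierstrassCurve NumberField IsDedekindDomain Literature Literature.NumberTheory.EllipticCurves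
  Literature.NumberTheory.GaloisRepresentations Literature.NumberTheory.EllipticCurves.GreenbergVatsal2000
  Literature.NumberTheory.EllipticCurves.Kobayashi2003 ZpExtension
  Literature.NumberTheory.EllipticCurves.GreenbergSelmer
  Literature.NumberTheory.EllipticCurves.Rank1Residual Literature.NumberTheory.EllipticCurves.IwasawaAlgebra
  Summit.BirchSwinnertonDyer.Rank1Residual.Iwasawa
  Summit.BirchSwinnertonDyer.BirchSwinnertonDyer.Theorems.SignedTransportAtTwo

namespace Summit.BirchSwinnertonDyer.BirchSwinnertonDyer.Theorems.SignedMuAtTwo.NormOneTorus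

universe u

/-! ## §1. Restriction along an equality of subgroups -/

section Generic

variable {G : Type u} [Group G] [TopologicalSpace G] [IsTopologicalGroup G]
variable {M : Type u} [AddCommGroup M] [DistribMulAction G M] [TopologicalSpace M] [DiscreteTopology M]

/-- Restriction `H¹(H, M) → H¹(H', M)` along an EQUALITY `H' = H` of subgroups is a bijection (it is the identity after `subst`).
[folklore] -/
theorem resOfLe_bijective_of_eq {H H' : Subgroup G} (h : H' = H) :
    Function.Bijective (Literature.NumberTheory.EllipticCurves.resOfLe M h.le) := by
  subst h
  have : Literature.NumberTheory.EllipticCurves.resOfLe M (le_refl H') = AddMonoidHom.id _ :=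
    Literature.NumberTheory.EllipticCurves.resOfLe_refl_holds (M := M) H'
  rw [show Literature.NumberTheory.EllipticCurves.resOfLe M (Eq.refl H').le =
      Literature.NumberTheory.EllipticCurves.resOfLe M (le_refl H') from rfl, this]
  exact Function.bijective_id

end Generic

/-! ## §2. Archimedean decomposition groups lie in `ker κ` -/

section Arch

variable {K : Type u} [Field K] [NumberField K] {p : ℕ} [Fact p.Prime] (κ : ZpExtension K p)

omit [NumberField K] in
/-- **`D_w ≤ ker κ` for every infinite place `w`** and every `ℤ_p`-extension `κ`: `D_w` is the image of `Γ_{K_w}`, a group of order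
`≤ 2`, and `ℤ_p` has no torsion. [cite: SerreGaloisCohomology1997, I §2.4] [cite: Washington1997, §13.1] -/
theorem decompInf_le_kerSubgroup (w : InfinitePlace K) : decompInf w ≤ κ.kerSubgroup := by
  rintro g ⟨τ, rfl⟩
  haveI := finite_absoluteGaloisGroup_completion_infinitePlace w
  set n := Nat.card (Field.absoluteGaloisGroup w.Completion) with hn
  have hn0 : n ≠ 0 := Nat.card_pos.ne'
  have hτ : τ ^ n = 1 := pow_card_eq_one'
  rw [ZpExtension.mem_kerSubgroup]
  apply Multiplicative.toAdd.injective
  rw [toAdd_one]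
  have h1 : n • (κ ((absGaloisRestrict K w.Completion).toMonoidHom τ)).toAdd = 0 := by
    rw [← toAdd_pow, ← map_pow, ← map_pow, hτ, map_one, map_one, toAdd_one]
  rw [nsmul_eq_mul, mul_eq_zero] at h1
  exact h1.resolve_left (Nat.cast_ne_zero.mpr hn0)

end Arch

/-! ## §3. Transport of the unramified and archimedean conditions along `H' ≤ H` -/

section Transport

variable {K : Type u} [Field K] [NumberField K] {H H' : Subgroup (Field.absoluteGaloisGroup K)}
variable (M : Type u) [AddCommGroup M] [DistribMulAction (Field.absoluteGaloisGroup K) M] [TopologicalSpace M]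
  [DiscreteTopology M]

/-- `H' ≤ H ⇒ H' ⊓ I_v ≤ H ⊓ I_v` (inside `D_v`). [folklore] -/
theorem inertiaIn_mono (hle : H' ≤ H) (v : HeightOneSpectrum (𝓞 K)) : inertiaIn H' v ≤ inertiaIn H v := fun x hx ↦
  (mem_inertiaIn_iff H v x).mpr ⟨hle ((mem_inertiaIn_iff H' v x).mp hx).1, ((mem_inertiaIn_iff H' v x).mp hx).2⟩

/-- **Unramified-at-`v` is insensitive to restriction when `I_v ≤ H'`**: for `H' ≤ H` with `I_v ≤ H'` and `c ∈ H¹(H, M)`,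
`res c ∈ unramifiedKer H' M v ↔ c ∈ unramifiedKer H M v` (both say `c|_{I_v} = 0`; `H' ⊓ I_v = H ⊓ I_v = I_v`).
[cite: GreenbergVatsal2000, §2 p. 17] -/
theorem resOfLe_mem_unramifiedKer_iff (hle : H' ≤ H) (v : HeightOneSpectrum (𝓞 K)) (hv : inertia (K := K) v ≤ H')
    (c : subgroupH1 H M) :
    Literature.NumberTheory.EllipticCurves.resOfLe M hle c ∈ GreenbergVatsal2000.unramifiedKer H' M v ↔
      c ∈ GreenbergVatsal2000.unramifiedKer H M v := by
  -- the two inertia subgroups inside `D_v` coincide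
  have hA : inertiaIn H' v ≤ inertiaIn H v := inertiaIn_mono hle v
  have hA' : inertiaIn H v ≤ inertiaIn H' v := fun x hx ↦
    (mem_inertiaIn_iff H' v x).mpr ⟨hv ((mem_inertiaIn_iff H v x).mp hx).2, ((mem_inertiaIn_iff H v x).mp hx).2⟩
  have heq : inertiaIn H' v = inertiaIn H v := le_antisymm hA hA'
  -- functoriality: `res_{I'} ∘ res_{H'≤H} = res_{I'≤I} ∘ res_I`
  have hcomm : (resH1Hom (inertiaInToH H' v) (AddMonoidHom.id M) fun _ _ ↦ rfl)
        (Literature.NumberTheory.EllipticCurves.resOfLe M hle c) =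
      Literature.NumberTheory.EllipticCurves.resOfLe M hA
        ((resH1Hom (inertiaInToH H v) (AddMonoidHom.id M) fun _ _ ↦ rfl) c) := by
    have e1 := DFunLike.congr_fun (resH1Hom_comp (Literature.NumberTheory.EllipticCurves.subgroupInclusion hle)
      (AddMonoidHom.id M) (fun _ _ ↦ rfl) (inertiaInToH H' v) (AddMonoidHom.id M) (fun _ _ ↦ rfl)) c
    have e2 := DFunLike.congr_fun (resH1Hom_comp (inertiaInToH H v) (AddMonoidHom.id M) (fun _ _ ↦ rfl)
      (Literature.NumberTheory.EllipticCurves.subgroupInclusion hA) (AddMonoidHom.id M) (fun _ _ ↦ rfl)) c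
    simp only [AddMonoidHom.coe_comp, Function.comp_apply] at e1 e2
    change (resH1Hom (inertiaInToH H' v) (AddMonoidHom.id M) _)
        (resH1Hom (Literature.NumberTheory.EllipticCurves.subgroupInclusion hle) (AddMonoidHom.id M) _ c) =
      (resH1Hom (Literature.NumberTheory.EllipticCurves.subgroupInclusion hA) (AddMonoidHom.id M) _)
        (resH1Hom (inertiaInToH H v) (AddMonoidHom.id M) _ c)
    rw [e1, e2]
    exact DFunLike.congr_fun (resH1Hom_congr (by ext; rfl) rfl _ _) c
  rw [GreenbergVatsal2000.unramifiedKer, GreenbergVatsal2000.unramifiedKer, AddMonoidHom.mem_ker, AddMonoidHom.mem_ker, hcomm]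
  constructor
  · intro h
    exact (resOfLe_bijective_of_eq heq).1 (by rw [map_zero]; exact h)
  · intro h
    rw [h, map_zero]

omit [NumberField K] in
/-- **Locally-trivial-at-`∞` is insensitive to restriction when `D_w ≤ H'`**: for `H' ≤ H` with `D_w ≤ H'` and `c ∈ H¹(H, M)`,
`res c ∈ infKer H' M w ↔ c ∈ infKer H M w` (`H' ⊓ D_w = H ⊓ D_w = D_w`). [cite: Greenberg1989, §1 p. 98 (3)] -/
theorem resOfLe_mem_infKer_iff (hle : H' ≤ H) (w : InfinitePlace K) (hw : decompInf w ≤ H') (c : subgroupH1 H M) :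
    Literature.NumberTheory.EllipticCurves.resOfLe M hle c ∈ GreenbergSelmer.infKer H' M w ↔
      c ∈ GreenbergSelmer.infKer H M w := by
  have hB : H' ⊓ decompInf w ≤ H ⊓ decompInf w := inf_le_inf_right _ hle
  have hB' : H ⊓ decompInf w ≤ H' ⊓ decompInf w := le_inf (inf_le_right.trans hw) inf_le_right
  have heq : H' ⊓ decompInf w = H ⊓ decompInf w := le_antisymm hB hB'
  have hcomm : Literature.NumberTheory.EllipticCurves.resOfLe M (inf_le_left : H' ⊓ decompInf w ≤ H')
        (Literature.NumberTheory.EllipticCurves.resOfLe M hle c) =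
      Literature.NumberTheory.EllipticCurves.resOfLe M hB
        (Literature.NumberTheory.EllipticCurves.resOfLe M (inf_le_left : H ⊓ decompInf w ≤ H) c) := by
    have e1 := DFunLike.congr_fun (Literature.NumberTheory.EllipticCurves.resOfLe_comp_holds (M := M)
      (inf_le_left : H' ⊓ decompInf w ≤ H') hle) c
    have e2 := DFunLike.congr_fun (Literature.NumberTheory.EllipticCurves.resOfLe_comp_holds (M := M)
      hB (inf_le_left : H ⊓ decompInf w ≤ H)) c
    simp only [AddMonoidHom.coe_comp, Function.comp_apply] at e1 e2
    rw [e1, e2]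
  rw [GreenbergSelmer.infKer, GreenbergSelmer.infKer, AddMonoidHom.mem_ker, AddMonoidHom.mem_ker, hcomm]
  constructor
  · intro h
    exact (resOfLe_bijective_of_eq heq).1 (by rw [map_zero]; exact h)
  · intro h
    rw [h, map_zero]

end Transport

/-! ## §4. The `q = 1` certificate with the conditions away from `2` read over `ℚ_0` -/

section LayerZeroLocal

variable (W : WeierstrassCurve ℚ) [W.IsElliptic] [W.IsGloballyMinimal]

omit [W.IsElliptic] [W.IsGloballyMinimal] in
/-- Conjugation acts trivially on `H¹(ℚ_0, M)` (`Γ_{ℚ_0} = Γ_ℚ`; inner automorphisms). [cite: SerreLocalFields1979, VII.§5 Prop. 3] -/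
theorem conjH1_layerZero_eq (κ : ZpExtension ℚ 2) (σ : Field.absoluteGaloisGroup ℚ)
    (c₀ : subgroupH1 (κ.layerSubgroup 0) ↥((↥(W.geomPrimaryTorsion 2))[(2 : ℤ)])) :
    Literature.NumberTheory.EllipticCurves.conjH1 (κ.layerSubgroup 0) ↥((↥(W.geomPrimaryTorsion 2))[(2 : ℤ)]) σ c₀ = c₀ := by
  have hσ : σ ∈ κ.layerSubgroup 0 := by rw [κ.layerSubgroup_zero]; exact Subgroup.mem_top σ
  rw [Literature.NumberTheory.EllipticCurves.conjH1_of_mem_holds (κ.layerSubgroup 0) _ hσ, AddMonoidHom.id_apply]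

omit [W.IsElliptic] [W.IsGloballyMinimal] in
/-- **(a) over `ℚ_∞` ⟺ (a₀) over `ℚ_0`**: the restriction of `c₀ ∈ H¹(ℚ_0, W[2^∞][2])` is unramified at every odd place over `ℚ_∞`
iff `c₀` is (`I_v ≤ ker κ ≤ Γ_{ℚ_0}` for odd `v`: `ℤ₂`-extensions are unramified outside `2`). [cite: Washington1997, Prop. 13.2]
[cite: GreenbergVatsal2000, §2 p. 17] -/
theorem resOfLe_mem_unramifiedOutside_iff (κ : ZpExtension ℚ 2)
    (c₀ : subgroupH1 (κ.layerSubgroup 0) ↥((↥(W.geomPrimaryTorsion 2))[(2 : ℤ)])) :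
    Literature.NumberTheory.EllipticCurves.resOfLe ↥((↥(W.geomPrimaryTorsion 2))[(2 : ℤ)]) (κ.kerSubgroup_le_layerSubgroup 0) c₀ ∈
        unramifiedOutside κ.kerSubgroup ↥((↥(W.geomPrimaryTorsion 2))[(2 : ℤ)]) 2 (∅ : Set (HeightOneSpectrum (𝓞 ℚ))) ↔
      c₀ ∈ unramifiedOutside (κ.layerSubgroup 0) ↥((↥(W.geomPrimaryTorsion 2))[(2 : ℤ)]) 2 (∅ : Set (HeightOneSpectrum (𝓞 ℚ))) := by
  rw [mem_unramifiedOutside_iff, mem_unramifiedOutside_iff]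
  refine forall_congr' fun v ↦ forall_congr' fun hvS ↦ forall_congr' fun hv2 ↦ forall_congr' fun σ ↦ ?_
  have hv2' : ((2 : ℕ) : 𝓞 ℚ) ∉ v.asIdeal := hv2
  rw [conjH1_resOfLe_layerZero W κ σ c₀, conjH1_layerZero_eq W κ σ c₀]
  exact resOfLe_mem_unramifiedKer_iff _ (κ.kerSubgroup_le_layerSubgroup 0) v (inertia_le_kerSubgroup' κ v hv2') c₀

omit [W.IsElliptic] [W.IsGloballyMinimal] in
/-- **(b) over `ℚ_∞` ⟺ (b₀) over `ℚ_0`**: all conjugates of the restriction of `c₀` are locally trivial at `∞` over `ℚ_∞` iff `c₀` is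
locally trivial at `∞` over `ℚ_0` (`D_w ≤ ker κ`). [cite: Greenberg1989, §1 p. 98 (3)] [cite: SerreGaloisCohomology1997, I §2.4] -/
theorem forall_conjH1_resOfLe_mem_infKer_iff (κ : ZpExtension ℚ 2)
    (c₀ : subgroupH1 (κ.layerSubgroup 0) ↥((↥(W.geomPrimaryTorsion 2))[(2 : ℤ)])) :
    (∀ (w : InfinitePlace ℚ) (σ : Field.absoluteGaloisGroup ℚ),
        Literature.NumberTheory.EllipticCurves.conjH1 κ.kerSubgroup ↥((↥(W.geomPrimaryTorsion 2))[(2 : ℤ)]) σ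
            (Literature.NumberTheory.EllipticCurves.resOfLe ↥((↥(W.geomPrimaryTorsion 2))[(2 : ℤ)])
              (κ.kerSubgroup_le_layerSubgroup 0) c₀) ∈
          GreenbergSelmer.infKer κ.kerSubgroup ↥((↥(W.geomPrimaryTorsion 2))[(2 : ℤ)]) w) ↔
      ∀ w : InfinitePlace ℚ, c₀ ∈ GreenbergSelmer.infKer (κ.layerSubgroup 0) ↥((↥(W.geomPrimaryTorsion 2))[(2 : ℤ)]) w := by
  refine forall_congr' fun w ↦ ⟨fun h ↦ ?_, fun h σ ↦ ?_⟩
  · have h1 := h 1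
    rw [conjH1_resOfLe_layerZero W κ 1 c₀] at h1
    exact (resOfLe_mem_infKer_iff _ (κ.kerSubgroup_le_layerSubgroup 0) w (decompInf_le_kerSubgroup κ w) c₀).mp h1
  · rw [conjH1_resOfLe_layerZero W κ σ c₀]
    exact (resOfLe_mem_infKer_iff _ (κ.kerSubgroup_le_layerSubgroup 0) w (decompInf_le_kerSubgroup κ w) c₀).mpr h

/-- **`PrimCertificate W κ γ 1` ⟺ no non-zero class of `H¹(ℚ_0, W[2^∞][2])` is (a₀) unramified at every odd place over `ℚ_0`,
(b₀) locally trivial at `∞` over `ℚ_0`, and (c) signed-plus at `2` after restriction to `ℚ_∞`** (`W/ℚ` globally minimal, good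
supersingular at `2`; `κ` any `ℤ₂`-extension, `γ` a topological generator). `primCertificate_one_iff_layerZero` (p609373) with the two
conditions away from `2` brought down to `ℚ_0` by §3. [cite: GreenbergLNM1716, §3 Lemmas 3.1–3.2 (PDF p. 86)]
[cite: Washington1997, Prop. 13.2] [cite: Fukuda1994, Thm. 1] -/
theorem primCertificate_one_iff_layerZero_local (hss : GoodSS W 2) (κ : ZpExtension ℚ 2) (γ : Field.absoluteGaloisGroup ℚ)
    (hγ : κ.IsTopGenerator γ) :
    (∃ F : Finset (subgroupH1 κ.kerSubgroup ↥((↥(W.geomPrimaryTorsion 2))[(2 : ℤ)])),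
        (∀ c, c ∈ F ↔ (c ∈
          {c : subgroupH1 κ.kerSubgroup ↥((↥(W.geomPrimaryTorsion 2))[(2 : ℤ)]) |
            c ∈ unramifiedOutside κ.kerSubgroup ↥((↥(W.geomPrimaryTorsion 2))[(2 : ℤ)]) 2
                  (∅ : Set (HeightOneSpectrum (𝓞 ℚ))) ∧
              (∀ (w : InfinitePlace ℚ) (σ : Field.absoluteGaloisGroup ℚ),
                Literature.NumberTheory.EllipticCurves.conjH1 κ.kerSubgroup ↥((↥(W.geomPrimaryTorsion 2))[(2 : ℤ)]) σ c ∈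
                  GreenbergSelmer.infKer κ.kerSubgroup ↥((↥(W.geomPrimaryTorsion 2))[(2 : ℤ)]) w) ∧
              (∀ (v : HeightOneSpectrum (𝓞 ℚ)), ((2 : ℕ) : 𝓞 ℚ) ∈ v.asIdeal → ∀ σ : Field.absoluteGaloisGroup ℚ,
                W.conjH1 2 κ.kerSubgroup σ
                    (pushH1 κ.kerSubgroup ((↥(W.geomPrimaryTorsion 2))[(2 : ℤ)]).subtype (subtype_torsionBy_smul W 2) c) ∈
                  localKummerOverOfEmb W 2 κ.kerSubgroup (closureEmb (K := ℚ) (v.adicCompletion ℚ))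
                    (⨆ n : ℕ, signedLocalPoints κ (v.adicCompletion ℚ) W 1 n))} ∧
          ((@HSub.hSub (AddMonoid.End (subgroupH1 κ.kerSubgroup ↥((↥(W.geomPrimaryTorsion 2))[(2 : ℤ)])))
              (AddMonoid.End (subgroupH1 κ.kerSubgroup ↥((↥(W.geomPrimaryTorsion 2))[(2 : ℤ)])))
              (AddMonoid.End (subgroupH1 κ.kerSubgroup ↥((↥(W.geomPrimaryTorsion 2))[(2 : ℤ)]))) instHSub
              (Literature.NumberTheory.EllipticCurves.conjH1 κ.kerSubgroup ↥((↥(W.geomPrimaryTorsion 2))[(2 : ℤ)]) γ) 1) ^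
            1) c = 0)) ∧
        F.card < 2 ^ 1) ↔
    (∀ c₀ : subgroupH1 (κ.layerSubgroup 0) ↥((↥(W.geomPrimaryTorsion 2))[(2 : ℤ)]),
      c₀ ∈ unramifiedOutside (κ.layerSubgroup 0) ↥((↥(W.geomPrimaryTorsion 2))[(2 : ℤ)]) 2 (∅ : Set (HeightOneSpectrum (𝓞 ℚ))) →
      (∀ w : InfinitePlace ℚ, c₀ ∈ GreenbergSelmer.infKer (κ.layerSubgroup 0) ↥((↥(W.geomPrimaryTorsion 2))[(2 : ℤ)]) w) →
      (∀ (v : HeightOneSpectrum (𝓞 ℚ)), ((2 : ℕ) : 𝓞 ℚ) ∈ v.asIdeal → ∀ σ : Field.absoluteGaloisGroup ℚ,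
          W.conjH1 2 κ.kerSubgroup σ
              (pushH1 κ.kerSubgroup ((↥(W.geomPrimaryTorsion 2))[(2 : ℤ)]).subtype (subtype_torsionBy_smul W 2)
                (Literature.NumberTheory.EllipticCurves.resOfLe ↥((↥(W.geomPrimaryTorsion 2))[(2 : ℤ)])
                  (κ.kerSubgroup_le_layerSubgroup 0) c₀)) ∈
            localKummerOverOfEmb W 2 κ.kerSubgroup (closureEmb (K := ℚ) (v.adicCompletion ℚ))
              (⨆ n : ℕ, signedLocalPoints κ (v.adicCompletion ℚ) W 1 n)) →
      c₀ = 0) := by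
  rw [primCertificate_one_iff_layerZero W hss κ γ hγ]
  refine forall_congr' fun c₀ ↦ ?_
  rw [resOfLe_mem_unramifiedOutside_iff W κ c₀, forall_conjH1_resOfLe_mem_infKer_iff W κ c₀]
  exact ⟨fun h ha hb hc ↦ h ⟨ha, hb, hc⟩, fun h habc ↦ h habc.1 habc.2.1 habc.2.2⟩

end LayerZeroLocal

end Summit.BirchSwinnertonDyer.BirchSwinnertonDyer.Theorems.SignedMuAtTwo.NormOneTorus

end
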